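import Summits.ResolutionOfSingularities.ResolutionOfSingularities.Theorems.EquisingularLiftEquisingularLiftNatResidueHypDefsND
import HarnessLib

/-!
# [OURS · L1 W4.5(b) · EL♮(3) · D-0157 DOOR 1, WIDTH row iso-w3] GERM-LEVEL SPECIMEN `G3 = x⁴ + (xy² + z³)² + y⁹ + y⁷z`:
# CONVENIENT, and NOT locally Newton-nondegenerate in the given coordinates

OURS · L1 W4.5(b) · EL♮(3) stmt-ResolutionOfSingularities-20148 · counted 0 · AI-written (res-L1-w45b-iso-w3 g0, WIDTH TABLE D1′ row
iso-w3, desk res-L1-w45b-plan-1 g21 2026-08-28T14:40:28Z), weaker than expert review; nothing of [Hironaka2017] asserted; no statement of the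
manuscript. Sorry-free, standard axioms, no instance, no notation, def-light (three small `def`s: the specimen polynomial, its witness
weight, its exponent vectors). `--supports stmt-ResolutionOfSingularities-20148 --as helper`.

WHAT. res-L1-w45b-lead-1's (m5) probe germ `G3` (ND-SPECIMEN-PASS-4.md 5467ab03a9bcb1c0 §7, kit j309390 / j309578), the first hand-built
NON-Newton-nondegenerate ISOLATED customer tried against the A‴/A⁗ Def-tower engine of the isolated research residue
`stub_elnat_three_isolated_nonDefTowerBQuadPrime` (CHILD v40).  Here we certify in the kernel, over EVERY field `k`:
* `specimenG3 k = X 0 ^ 4 + (X 0 * X 1 ^ 2 + X 2 ^ 3) ^ 2 + X 1 ^ 9 + X 1 ^ 7 * X 2` (definition) and its coefficient table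
  `{(4,0,0) ↦ 1, (2,4,0) ↦ 1, (1,2,3) ↦ 2, (0,0,6) ↦ 1, (0,9,0) ↦ 1, (0,7,1) ↦ 1}` (`coeff_specimenG3`);
* `isConvenient_specimenG3` — pure powers `x⁴`, `y⁹`, `z⁶` with coefficient `1`, no constant term (tree def `IsConvenient`, …NatResidueHypDefsND p625534);
* `initialForm_weightG3_specimenG3` — the POSITIVE weight `w = (86, 41, 56)` cuts out the compact EDGE `{x²y⁴, 2xy²z³, z⁶}` of the Newton polyhedron
  (weights `344, 336, 336, 336, 369, 343`), so the initial form is the SQUARE `(xy² + z³)²`;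
* ★ `not_isLocallyNewtonNondegenerate_specimenG3` — at the torus point `(1, 1, −1)` one has `xy² + z³ = 0`, hence the initial form and all its partial
  derivatives vanish: Kouchnirenko's local condition (tree def `IsLocallyNewtonNondegenerate`) FAILS, in every characteristic;
* hence `not_localND_specimenG3`, `not_localNDWon_specimenG3` (tree defs `LocalND`, `LocalNDWon`).

HONEST SCOPE. This is a statement about ONE polynomial in ONE coordinate system: it certifies that the ND lane's local datum `LocalND` / `LocalNDWon`
does not hold for `G3` AS WRITTEN.  It does NOT prove `¬ IsoHypNDWon` for the projective surface `V₊(G3ʰ)` (that quantifies over all charts and all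
origin-fixing polynomial automorphisms — a genuine theorem, not claimed), it says nothing about isolatedness (lead-1's Sage: μ finite, candidate), and
nothing scheme-level about `IsoHypDefTowerBTriplePrime` / `IsoHypDefTowerBQuadPrime` (the desk WITHDREW that ambition of the row on the size word,
STATUS 2026-08-28T14:40:28Z).  Dim-3 char-p resolution is a theorem in print (Cossart–Piltant 2008/2009); everything here is OUR kernel-own bookkeeping,
counted 0 toward the summit.
-/

noncomputable section

set_option linter.dupNamespace false

open MvPolynomial

namespace Summit.ResolutionOfSingularities.ResolutionOfSingularities.Cruxes.EquisingularLiftNat.Sections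

variable (k : Type) [Field k]

/-! ## The specimen and its bookkeeping -/

/-- **The specimen germ `G3 = x⁴ + (xy² + z³)² + y⁹ + y⁷z`** (res-L1-w45b-lead-1 (m5), ND-SPECIMEN-PASS-4 §7) as a polynomial in `k[X₀, X₁, X₂]`
(`x = X 0`, `y = X 1`, `z = X 2`). [OURS · L1 W4.5b · specimen object] -/
def specimenG3 : MvPolynomial (Fin 3) k :=
  X 0 ^ 4 + (X 0 * X 1 ^ 2 + X 2 ^ 3) ^ 2 + X 1 ^ 9 + X 1 ^ 7 * X 2

/-- The witness weight `w = (86, 41, 56)` (positive; it selects the compact edge `{x²y⁴, xy²z³, z⁶}` of `Γ₊(G3)`). [OURS · L1 W4.5b · specimen object] -/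
def weightG3 : Fin 3 → ℤ := ![86, 41, 56]

/-- Exponent vectors `(a, b, c) ↦ x^a y^b z^c` as finitely supported functions. [OURS · L1 W4.5b · bookkeeping] -/
def eG3 (a b c : ℕ) : Fin 3 →₀ ℕ := Finsupp.single 0 a + Finsupp.single 1 b + Finsupp.single 2 c

variable {k}

/-- Values of `eG3 a b c`. [OURS · bookkeeping] -/
theorem eG3_apply_zero (a b c : ℕ) : eG3 a b c 0 = a := by simp [eG3]

/-- Values of `eG3 a b c`. [OURS · bookkeeping] -/
theorem eG3_apply_one (a b c : ℕ) : eG3 a b c 1 = b := by simp [eG3]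

/-- Values of `eG3 a b c`. [OURS · bookkeeping] -/
theorem eG3_apply_two (a b c : ℕ) : eG3 a b c 2 = c := by simp [eG3]

/-- `eG3` is injective on triples. [OURS · bookkeeping] -/
theorem eG3_eq_iff {a b c a' b' c' : ℕ} : eG3 a b c = eG3 a' b' c' ↔ a = a' ∧ b = b' ∧ c = c' := by
  constructor
  · intro h
    refine ⟨?_, ?_, ?_⟩
    · simpa [eG3_apply_zero] using DFunLike.congr_fun h 0
    · simpa [eG3_apply_one] using DFunLike.congr_fun h 1
    · simpa [eG3_apply_two] using DFunLike.congr_fun h 2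
  · rintro ⟨rfl, rfl, rfl⟩; rfl

/-- Every exponent of `Fin 3` is an `eG3`. [OURS · bookkeeping] -/
theorem eG3_eta (d : Fin 3 →₀ ℕ) : eG3 (d 0) (d 1) (d 2) = d := by
  ext i
  fin_cases i
  · simp [eG3_apply_zero]
  · simp [eG3_apply_one]
  · simp [eG3_apply_two]

/-- The weight of `x^a y^b z^c` under `w = (86, 41, 56)`. [OURS · bookkeeping] -/
theorem wt_weightG3_eG3 (a b c : ℕ) : wt weightG3 (eG3 a b c) = 86 * a + 41 * b + 56 * c := by
  simp [wt, weightG3, Fin.sum_univ_three, eG3_apply_zero, eG3_apply_one, eG3_apply_two]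

/-- A monomial `x^a y^b z^c` written with `eG3`. [OURS · bookkeeping] -/
theorem monomial_eG3 (a b c : ℕ) (r : k) :
    monomial (eG3 a b c) r = C r * X 0 ^ a * X 1 ^ b * X 2 ^ c := by
  rw [eG3, C_mul_X_pow_eq_monomial, X_pow_eq_monomial, X_pow_eq_monomial, monomial_mul, monomial_mul]
  simp

/-- **The monomial expansion of `G3`**: `x⁴ + x²y⁴ + 2xy²z³ + z⁶ + y⁹ + y⁷z`. [OURS · L1 W4.5b · bookkeeping] -/
theorem specimenG3_eq_sum_monomial :
    specimenG3 k = monomial (eG3 4 0 0) 1 + monomial (eG3 2 4 0) 1 + monomial (eG3 1 2 3) 2 + monomial (eG3 0 0 6) 1 +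
      monomial (eG3 0 9 0) 1 + monomial (eG3 0 7 1) 1 := by
  simp only [specimenG3, monomial_eG3, map_one, map_ofNat, one_mul, pow_zero, mul_one]
  ring

/-- **The coefficient table of `G3`.** [OURS · L1 W4.5b · bookkeeping] -/
theorem coeff_specimenG3 (d : Fin 3 →₀ ℕ) :
    coeff d (specimenG3 k) = (if eG3 4 0 0 = d then 1 else 0) + (if eG3 2 4 0 = d then 1 else 0) + (if eG3 1 2 3 = d then 2 else 0) +
      (if eG3 0 0 6 = d then 1 else 0) + (if eG3 0 9 0 = d then 1 else 0) + (if eG3 0 7 1 = d then 1 else 0) := by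
  simp only [specimenG3_eq_sum_monomial, coeff_add, coeff_monomial]

/-- The square `(xy² + z³)²` expanded: `x²y⁴ + 2xy²z³ + z⁶`. [OURS · bookkeeping] -/
theorem sq_edgeG3_eq_sum_monomial :
    ((X 0 * X 1 ^ 2 + X 2 ^ 3) ^ 2 : MvPolynomial (Fin 3) k) =
      monomial (eG3 2 4 0) 1 + monomial (eG3 1 2 3) 2 + monomial (eG3 0 0 6) 1 := by
  simp only [monomial_eG3, map_one, map_ofNat, one_mul, pow_zero, mul_one]
  ring

/-- Coefficients of `(xy² + z³)²`. [OURS · bookkeeping] -/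
theorem coeff_sq_edgeG3 (d : Fin 3 →₀ ℕ) :
    coeff d ((X 0 * X 1 ^ 2 + X 2 ^ 3) ^ 2 : MvPolynomial (Fin 3) k) =
      (if eG3 2 4 0 = d then 1 else 0) + (if eG3 1 2 3 = d then 2 else 0) + (if eG3 0 0 6 = d then 1 else 0) := by
  simp only [sq_edgeG3_eq_sum_monomial, coeff_add, coeff_monomial]

/-- Every exponent in the support of `G3` has `w`-weight `≥ 336` (`344, 336, 336, 336, 369, 343`). [OURS · L1 W4.5b] -/
theorem le_wt_of_mem_support_specimenG3 {d : Fin 3 →₀ ℕ} (hd : d ∈ (specimenG3 k).support) : 336 ≤ wt weightG3 d := by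
  rw [mem_support_iff, coeff_specimenG3] at hd
  by_cases h1 : eG3 4 0 0 = d
  · rw [← h1, wt_weightG3_eG3]; norm_num
  by_cases h2 : eG3 2 4 0 = d
  · rw [← h2, wt_weightG3_eG3]; norm_num
  by_cases h3 : eG3 1 2 3 = d
  · rw [← h3, wt_weightG3_eG3]; norm_num
  by_cases h4 : eG3 0 0 6 = d
  · rw [← h4, wt_weightG3_eG3]; norm_num
  by_cases h5 : eG3 0 9 0 = d
  · rw [← h5, wt_weightG3_eG3]; norm_num
  by_cases h6 : eG3 0 7 1 = d
  · rw [← h6, wt_weightG3_eG3]; norm_num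
  simp [h1, h2, h3, h4, h5, h6] at hd

/-- `x²y⁴` is in the support of `G3` (coefficient `1`). [OURS · L1 W4.5b] -/
theorem eG3_240_mem_support_specimenG3 : eG3 2 4 0 ∈ (specimenG3 k).support := by
  rw [mem_support_iff, coeff_specimenG3]
  have h1 : ¬ eG3 4 0 0 = eG3 2 4 0 := by rw [eG3_eq_iff]; omega
  have h3 : ¬ eG3 1 2 3 = eG3 2 4 0 := by rw [eG3_eq_iff]; omega
  have h4 : ¬ eG3 0 0 6 = eG3 2 4 0 := by rw [eG3_eq_iff]; omega
  have h5 : ¬ eG3 0 9 0 = eG3 2 4 0 := by rw [eG3_eq_iff]; omega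
  have h6 : ¬ eG3 0 7 1 = eG3 2 4 0 := by rw [eG3_eq_iff]; omega
  simp [h1, h3, h4, h5, h6]

/-- The support of `G3` is nonempty. [OURS · L1 W4.5b] -/
theorem support_specimenG3_nonempty : (specimenG3 k).support.Nonempty := ⟨_, eG3_240_mem_support_specimenG3⟩

/-- **The minimal `w`-weight on the support of `G3` is `336`.** [OURS · L1 W4.5b] -/
theorem inf_wt_weightG3_specimenG3 :
    (specimenG3 k).support.inf' support_specimenG3_nonempty (wt weightG3) = 336 := by
  apply le_antisymm
  · refine (Finset.inf'_le _ eG3_240_mem_support_specimenG3).trans (le_of_eq ?_)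
    rw [wt_weightG3_eG3]; norm_num
  · exact Finset.le_inf' _ _ fun d hd => le_wt_of_mem_support_specimenG3 hd

/-! ## A general coefficient formula for the tree's `initialForm` -/

/-- **Coefficients of the initial form** (tree def `initialForm`, …NatResidueHypDefsND §2): for `F` with nonempty support, `coeff d (F_w)` is `coeff d F`
when `w(d)` equals the minimal weight on the support, and `0` otherwise. [OURS · L1 W4.5b · small print on the tree definition] -/
theorem coeff_initialForm {N : ℕ} (w : Fin N → ℤ) (F : MvPolynomial (Fin N) k) (hF : F.support.Nonempty) (d : Fin N →₀ ℕ) :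
    coeff d (initialForm w F) = if wt w d = F.support.inf' hF (wt w) then coeff d F else 0 := by
  classical
  unfold initialForm
  rw [dif_pos hF, coeff_sum]
  simp only [coeff_monomial]
  rw [Finset.sum_ite_eq' (F.support.filter _) d (fun x => coeff x F)]
  simp only [Finset.mem_filter, mem_support_iff, ne_eq]
  by_cases hc : coeff d F = 0
  · simp [hc]
  · simp [hc]

/-! ## The initial form on the edge and the failure of local Newton nondegeneracy -/

/-- **The initial form of `G3` for `w = (86, 41, 56)` is the square `(xy² + z³)²`.** [OURS · L1 W4.5b] -/
theorem initialForm_weightG3_specimenG3 :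
    initialForm weightG3 (specimenG3 k) = (X 0 * X 1 ^ 2 + X 2 ^ 3) ^ 2 := by
  ext d
  rw [coeff_initialForm weightG3 (specimenG3 k) support_specimenG3_nonempty, inf_wt_weightG3_specimenG3, coeff_sq_edgeG3,
    coeff_specimenG3]
  rw [← eG3_eta d, wt_weightG3_eG3]
  simp only [eG3_eq_iff]
  by_cases h240 : (2 = d 0 ∧ 4 = d 1 ∧ 0 = d 2)
  · obtain ⟨h0, h1, h2⟩ := h240
    rw [← h0, ← h1, ← h2]; norm_num
  by_cases h123 : (1 = d 0 ∧ 2 = d 1 ∧ 3 = d 2)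
  · obtain ⟨h0, h1, h2⟩ := h123
    rw [← h0, ← h1, ← h2]; norm_num
  by_cases h006 : (0 = d 0 ∧ 0 = d 1 ∧ 6 = d 2)
  · obtain ⟨h0, h1, h2⟩ := h006
    rw [← h0, ← h1, ← h2]; norm_num
  rw [if_neg h240, if_neg h123, if_neg h006]
  by_cases h400 : (4 = d 0 ∧ 0 = d 1 ∧ 0 = d 2)
  · obtain ⟨h0, h1, h2⟩ := h400
    rw [← h0, ← h1, ← h2]; norm_num
  by_cases h090 : (0 = d 0 ∧ 9 = d 1 ∧ 0 = d 2)
  · obtain ⟨h0, h1, h2⟩ := h090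
    rw [← h0, ← h1, ← h2]; norm_num
  by_cases h071 : (0 = d 0 ∧ 7 = d 1 ∧ 1 = d 2)
  · obtain ⟨h0, h1, h2⟩ := h071
    rw [← h0, ← h1, ← h2]; norm_num
  simp [h400, h090, h071]

/-- The torus point `(1, 1, −1)`. [OURS · L1 W4.5b · witness] -/
def torusPointG3 : Fin 3 → k := ![1, 1, -1]

/-- At `(1, 1, −1)` the edge binomial `xy² + z³` vanishes. [OURS · L1 W4.5b] -/
theorem eval_torusPointG3_edge : eval (torusPointG3 (k := k)) (X 0 * X 1 ^ 2 + X 2 ^ 3 : MvPolynomial (Fin 3) k) = 0 := by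
  simp [torusPointG3]
  norm_num

/-- **★ `G3` is NOT locally Newton-nondegenerate (in the given coordinates), over every field**: the positive weight `(86, 41, 56)` selects the
compact edge with initial form `(xy² + z³)²`, which together with all its partial derivatives vanishes at the torus point `(1, 1, −1)`.
[OURS · L1 W4.5b · germ-level certificate for res-L1-w45b-lead-1's (m5) specimen; honest scope in the module docstring] -/
theorem not_isLocallyNewtonNondegenerate_specimenG3 : ¬ IsLocallyNewtonNondegenerate (specimenG3 k) := by
  intro h
  have hw : ∀ i : Fin 3, 0 < weightG3 i := by
    intro i; fin_cases i <;> simp [weightG3]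
  have hx : ∀ i : Fin 3, torusPointG3 (k := k) i ≠ 0 := by
    intro i; fin_cases i <;> simp [torusPointG3]
  refine h weightG3 hw torusPointG3 hx ?_ ?_
  · rw [initialForm_weightG3_specimenG3, map_pow, eval_torusPointG3_edge]
    norm_num
  · intro i
    rw [initialForm_weightG3_specimenG3, sq, Derivation.leibniz, map_add, smul_eq_mul, map_mul, eval_torusPointG3_edge]
    simp

/-- The coefficient of `x^a y^b z^c` in `G3`, read off the table. [OURS · bookkeeping] -/
theorem coeff_specimenG3_eG3 (a b c : ℕ) : coeff (eG3 a b c) (specimenG3 k) =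
    (if (4 = a ∧ 0 = b ∧ 0 = c) then 1 else 0) + (if (2 = a ∧ 4 = b ∧ 0 = c) then 1 else 0) + (if (1 = a ∧ 2 = b ∧ 3 = c) then 2 else 0) +
      (if (0 = a ∧ 0 = b ∧ 6 = c) then 1 else 0) + (if (0 = a ∧ 9 = b ∧ 0 = c) then 1 else 0) + (if (0 = a ∧ 7 = b ∧ 1 = c) then 1 else 0) := by
  rw [coeff_specimenG3]
  simp only [eG3_eq_iff]

/-- `G3` has no constant term. [OURS · bookkeeping] -/
theorem coeff_zero_specimenG3 : coeff 0 (specimenG3 k) = 0 := by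
  have h0 : (0 : Fin 3 →₀ ℕ) = eG3 0 0 0 := by simp [eG3]
  rw [h0, coeff_specimenG3_eG3]
  norm_num

/-- The coefficient of `x⁴` in `G3` is `1`. [OURS · bookkeeping] -/
theorem coeff_x4_specimenG3 : coeff (Finsupp.single 0 4) (specimenG3 k) = 1 := by
  have h : (Finsupp.single 0 4 : Fin 3 →₀ ℕ) = eG3 4 0 0 := by simp [eG3]
  rw [h, coeff_specimenG3_eG3]
  norm_num

/-- The coefficient of `y⁹` in `G3` is `1`. [OURS · bookkeeping] -/
theorem coeff_y9_specimenG3 : coeff (Finsupp.single 1 9) (specimenG3 k) = 1 := by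
  have h : (Finsupp.single 1 9 : Fin 3 →₀ ℕ) = eG3 0 9 0 := by simp [eG3]
  rw [h, coeff_specimenG3_eG3]
  norm_num

/-- The coefficient of `z⁶` in `G3` is `1`. [OURS · bookkeeping] -/
theorem coeff_z6_specimenG3 : coeff (Finsupp.single 2 6) (specimenG3 k) = 1 := by
  have h : (Finsupp.single 2 6 : Fin 3 →₀ ℕ) = eG3 0 0 6 := by simp [eG3]
  rw [h, coeff_specimenG3_eG3]
  norm_num

/-- `G3` has no constant term and the pure powers `x⁴`, `y⁹`, `z⁶` with coefficient `1`: it is CONVENIENT (tree def `IsConvenient`), over every field.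
[OURS · L1 W4.5b] -/
theorem isConvenient_specimenG3 : IsConvenient (specimenG3 k) := by
  refine ⟨?_, fun i => ?_⟩
  · show coeff 0 (specimenG3 k) = 0
    exact coeff_zero_specimenG3
  · fin_cases i
    · exact ⟨4, by norm_num, ne_of_eq_of_ne coeff_x4_specimenG3 one_ne_zero⟩
    · exact ⟨9, by norm_num, ne_of_eq_of_ne coeff_y9_specimenG3 one_ne_zero⟩
    · exact ⟨6, by norm_num, ne_of_eq_of_ne coeff_z6_specimenG3 one_ne_zero⟩

/-- Hence the ND lane's local datum fails for `G3` as written: `¬ LocalND`. [OURS · L1 W4.5b] -/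
theorem not_localND_specimenG3 : ¬ LocalND (specimenG3 k) :=
  fun h => not_isLocallyNewtonNondegenerate_specimenG3 h.2

/-- … and a fortiori `¬ LocalNDWon` (no won play is asked for: the nondegeneracy clause already fails). [OURS · L1 W4.5b] -/
theorem not_localNDWon_specimenG3 : ¬ LocalNDWon (specimenG3 k) :=
  fun h => not_localND_specimenG3 h.1

end Summit.ResolutionOfSingularities.ResolutionOfSingularities.Cruxes.EquisingularLiftNat.Sections

end
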